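import Mathlib
import Summits.AtomisticToContinuum.HydrodynamicLimit.Theorems.ImplosionDichotomyDenseExcursionPackingAnalyticDefsB

/-!
# The transport max principle with inflow value: an a-priori bound for damped linear transport
# (crux `DenseExcursion`, stmt-AtomisticToContinuum-12586, line `sonic-cavity-renewal` v7, stub `stub_analyticPackingImplosion`)

Helper file (`--supports stmt-AtomisticToContinuum-12586`, line lead a2, wave-3 worker D, task (4) `sonicWindow_analytic_bound`,
third brick). On the sonic window the REGULAR characteristic of the order-`k` problem is the transport equation
`λ₋ m′ = (kμ − c₂₂) m − c₂₁ p − f_m` with `λ₋ < 0` and `kμ − c₂₂ > 0`, i.e. `m′ = −β(x) m + F(x)` with the DAMPING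
`β = (kμ − c₂₂)/|λ₋| ≥ β₀ ∼ k`: the value of `m` is anchored at the inflow edge `x_a` of the window (from `‖X_k‖₀`) and the
damping gives the `1/k` gain on the source (W6 report §4: "m by the transport max principle anchored at `x_a` with the VALUE
`m_k(x_a)`"). Kernel-checked here, the a-priori form for a GIVEN solution:

* `dampedTransport_apriori_bound` (REGISTERED helper): if `m′ = −β m + F` on `[a, b]` with `β ≥ β₀ > 0` and `|F| ≤ M` there,
  then `|m(x)| ≤ |m(a)| e^{−β₀(x−a)} + M/β₀` on `[a, b]` — comparison of `m²` with the strict supersolutions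
  `(E + εe^{x−a})²`, `E = |m(a)|e^{−β₀(x−a)} + (M/β₀)(1 − e^{−β₀(x−a)})`, by Mathlib's fencing theorem
  `image_le_of_deriv_right_lt_deriv_boundary'`, then `ε → 0`.

Elementary over Mathlib. NOT here: the window estimate itself, the `N_θ` scale, or `Γ`.
-/

noncomputable section

open Set Filter
open scoped Topology

namespace Summit.AtomisticToContinuum.HydrodynamicLimit.Theorems.PackingAnalyticImplosion

/-- **DAMPED TRANSPORT, A PRIORI** (registered helper `dampedTransport_apriori_bound` of `stub_analyticPackingImplosion`):
`m′ = −βm + F`, `β ≥ β₀ > 0`, `|F| ≤ M` on `[a, b]` ⇒ `|m(x)| ≤ |m(a)|e^{−β₀(x−a)} + M/β₀` on `[a, b]`. [folklore] -/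
theorem dampedTransport_apriori_bound : ∀ (β F m : ℝ → ℝ) (a b β₀ M : ℝ), a ≤ b → 0 < β₀ → (∀ x ∈ Set.Icc a b, β₀ ≤ β x) → (∀ x ∈ Set.Icc a b, |F x| ≤ M) → (∀ x ∈ Set.Icc a b, HasDerivAt m (-β x * m x + F x) x) → ∀ x ∈ Set.Icc a b, |m x| ≤ |m a| * Real.exp (-β₀ * (x - a)) + M / β₀ := by
  intro β F m a b β₀ M hab hβ₀ hβ hF hm x hx
  have hM : 0 ≤ M := (abs_nonneg _).trans (hF a (left_mem_Icc.2 hab))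
  have hmc : ContinuousOn m (Icc a b) := fun y hy => (hm y hy).continuousAt.continuousWithinAt
  -- the supersolution `E` and its strict perturbations `E + ε e^{x−a}`
  set E : ℝ → ℝ := fun y => |m a| * Real.exp (-β₀ * (y - a)) + M / β₀ * (1 - Real.exp (-β₀ * (y - a))) with hE
  have hEd : ∀ y, HasDerivAt E (-β₀ * E y + M) y := by
    intro y
    have h1 : HasDerivAt (fun y => Real.exp (-β₀ * (y - a))) (Real.exp (-β₀ * (y - a)) * (-β₀)) y := by
      have hl : HasDerivAt (fun y : ℝ => -β₀ * (y - a)) (-β₀ * 1) y := ((hasDerivAt_id y).sub_const a).const_mul (-β₀)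
      have h := (Real.hasDerivAt_exp (-β₀ * (y - a))).comp y hl
      exact h.congr_deriv (by ring)
    have h := (h1.const_mul |m a|).add ((h1.const_sub 1).const_mul (M / β₀))
    refine h.congr_deriv ?_
    simp only [hE]
    field_simp
    ring
  have hEpos : ∀ y, a ≤ y → 0 ≤ E y := by
    intro y hy
    have he : Real.exp (-β₀ * (y - a)) ≤ 1 := by
      rw [Real.exp_le_one_iff]; nlinarith
    have he0 : 0 < Real.exp (-β₀ * (y - a)) := Real.exp_pos _
    simp only [hE]
    have : 0 ≤ M / β₀ * (1 - Real.exp (-β₀ * (y - a))) := mul_nonneg (div_nonneg hM hβ₀.le) (by linarith)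
    positivity
  -- comparison of `m²` with `(E + ε e^{x−a})²` for every `ε > 0`
  have key : ∀ ε : ℝ, 0 < ε → m x ^ 2 ≤ (E x + ε * Real.exp (x - a)) ^ 2 := by
    intro ε hε
    set G : ℝ → ℝ := fun y => E y + ε * Real.exp (y - a) with hG
    have hGd : ∀ y, HasDerivAt G (-β₀ * E y + M + ε * Real.exp (y - a)) y := by
      intro y
      have h2 : HasDerivAt (fun y => ε * Real.exp (y - a)) (ε * Real.exp (y - a)) y := by
        have hl : HasDerivAt (fun y : ℝ => y - a) 1 y := (hasDerivAt_id y).sub_const a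
        have h := ((Real.hasDerivAt_exp (y - a)).comp y hl).const_mul ε
        exact h.congr_deriv (by ring)
      exact (hEd y).add h2
    have hGpos : ∀ y, a ≤ y → 0 < G y := fun y hy => by
      simp only [hG]; have := hEpos y hy; positivity
    have hcomp := image_le_of_deriv_right_lt_deriv_boundary' (f := fun y => m y ^ 2)
      (f' := fun y => 2 * m y * (-β y * m y + F y)) (a := a) (b := b)
      (hmc.pow 2) (fun y hy => by
        have h := ((hm y (Ico_subset_Icc_self hy)).pow 2).hasDerivWithinAt (s := Ici y)
        exact h.congr_deriv (by norm_num))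
      (B := fun y => G y ^ 2) (B' := fun y => 2 * G y * (-β₀ * E y + M + ε * Real.exp (y - a)))
      (by
        -- `m(a)² ≤ (|m a| + ε)²`
        have hG0 : G a = |m a| + ε := by simp [hG, hE]
        show m a ^ 2 ≤ G a ^ 2
        rw [hG0]
        nlinarith [abs_nonneg (m a), sq_abs (m a)])
      (fun y _ => ((hGd y).continuousAt.pow 2).continuousWithinAt)
      (fun y _ => by
        have h := ((hGd y).pow 2).hasDerivWithinAt (s := Ici y)
        exact h.congr_deriv (by norm_num))
      (fun y hy hyeq => by
        -- at a touching point `m² = G²`: `2m(−βm + F) ≤ 2|m|(−β₀|m| + M) < 2G·G′`-part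
        have hy' : a ≤ y := hy.1
        have hGy := hGpos y hy'
        have habs : |m y| = G y := by
          have h2 : |m y| ^ 2 = G y ^ 2 := by rw [sq_abs]; exact hyeq
          nlinarith [abs_nonneg (m y), sq_nonneg (|m y| - G y), sq_nonneg (|m y| + G y)]
        have hβy := hβ y (Ico_subset_Icc_self hy)
        have hFy := hF y (Ico_subset_Icc_self hy)
        have hmF : m y * F y ≤ |m y| * M := by
          calc m y * F y ≤ |m y * F y| := le_abs_self _
            _ = |m y| * |F y| := abs_mul _ _
            _ ≤ |m y| * M := mul_le_mul_of_nonneg_left hFy (abs_nonneg _)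
        have hm2 : m y ^ 2 = G y ^ 2 := hyeq
        have hEG : E y ≤ G y := by simp only [hG]; have := Real.exp_pos (y - a); nlinarith
        -- `f' = −2β m² + 2 m F ≤ −2β₀ G² + 2 G M < 2G(−β₀ E + M + ε e^{y−a})`
        have hexp := Real.exp_pos (y - a)
        nlinarith [mul_le_mul_of_nonneg_left hβy (sq_nonneg (m y)), hmF, habs, hGy, hexp,
          mul_pos hGy (mul_pos hε hexp), mul_nonneg hGy.le (sub_nonneg.2 hEG)])
    exact hcomp hx
  -- `ε → 0`
  have hlim : m x ^ 2 ≤ E x ^ 2 := by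
    have ht : Tendsto (fun ε : ℝ => (E x + ε * Real.exp (x - a)) ^ 2) (𝓝[>] 0) (𝓝 ((E x + 0 * Real.exp (x - a)) ^ 2)) :=
      ((tendsto_const_nhds.add (tendsto_id.mul tendsto_const_nhds)).pow 2).mono_left nhdsWithin_le_nhds
    rw [zero_mul, add_zero] at ht
    exact ge_of_tendsto ht (eventually_nhdsWithin_of_forall fun ε hε => key ε hε)
  have hEx := hEpos x hx.1
  have habs : |m x| ≤ E x := by
    have : |m x| ^ 2 ≤ E x ^ 2 := by rw [sq_abs]; exact hlim
    exact abs_le_of_sq_le_sq' (by nlinarith) hEx |>.2 |> fun h => by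
      nlinarith [abs_nonneg (m x), sq_nonneg (|m x| - E x), sq_abs (m x)]
  calc |m x| ≤ E x := habs
    _ ≤ |m a| * Real.exp (-β₀ * (x - a)) + M / β₀ := by
        simp only [hE]
        have he0 : 0 < Real.exp (-β₀ * (x - a)) := Real.exp_pos _
        have : M / β₀ * (1 - Real.exp (-β₀ * (x - a))) ≤ M / β₀ := by
          have h1 : 0 ≤ M / β₀ := div_nonneg hM hβ₀.le
          nlinarith
        linarith

end Summit.AtomisticToContinuum.HydrodynamicLimit.Theorems.PackingAnalyticImplosion

end
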